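import Summits.NavierStokesRegularity.NavierStokesRegularity.Theorems.ExtremiserTransienceNearExtremalTransienceExtremiserLiouvilleDensityErrors
import HarnessLib

/-!
# Crux `ExtremiserTransience.NearExtremalTransience` (stmt-NavierStokesRegularity-21883), line `extremiser_liouville`,
# stub K1b — `L²`-CONTINUITY OF LINEAR FUNCTIONALS ALONG THE TRUNCATIONS (tools for the speed plateau)

`--supports stmt-NavierStokesRegularity-21883` (helper).  Author: prover seat `ns-el-k1b` (g2).

Generic tools used to pass the first-variation functional of an extended extremiser to the limit along the solenoidal
truncations of `w − c`:

* `fderiv_curl_eq_zero_of_notMem_tsupport` — off `tsupport u`: `Du = 0`, `curl u = 0`, `D(curl u) = 0`;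
* `integrable_of_eq_zero_off_tsupport` — a continuous integrand vanishing off `tsupport u` (`u` compactly supported) is
  integrable;
* `tendsto_integral_of_sq_dominated` — if `‖f_R − f‖ₑ ≤ C·g·d_R` pointwise with `∫ g² < ∞` and `∫ d_R² → 0`, then
  `∫ f_R → ∫ f` (Cauchy–Schwarz).

WHAT THIS IS NOT: measure-theoretic bookkeeping only; nothing here proves NS regularity. [folklore]
-/

noncomputable section

open Set Filter Topology MeasureTheory Metric Function
open scoped ENNReal NNReal Topology InnerProductSpace RealInnerProductSpace
open Literature.Analysis.FluidPDE Literature.Analysis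

namespace Summit.NavierStokesRegularity.NavierStokesRegularity.Theorems

-- the problem directory repeats the summit name (`NavierStokesRegularity/NavierStokesRegularity`)
set_option linter.dupNamespace false

namespace ExtremiserLiouville

/-- Off the topological support of `u`, the derivative, the curl and the derivative of the curl vanish. [folklore] -/
theorem fderiv_curl_eq_zero_of_notMem_tsupport {u : EuclideanSpace ℝ (Fin 3) → EuclideanSpace ℝ (Fin 3)}
    {x : EuclideanSpace ℝ (Fin 3)} (hx : x ∉ tsupport u) :
    fderiv ℝ u x = 0 ∧ curl u x = 0 ∧ fderiv ℝ (curl u) x = 0 := by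
  have hev : u =ᶠ[𝓝 x] fun _ => (0 : EuclideanSpace ℝ (Fin 3)) := notMem_tsupport_iff_eventuallyEq.1 hx
  have hD : ∀ y, (u =ᶠ[𝓝 y] fun _ => (0 : EuclideanSpace ℝ (Fin 3))) → fderiv ℝ u y = 0 := fun y hy => by
    rw [hy.fderiv_eq, fderiv_const_apply]
  have h1 : fderiv ℝ u x = 0 := hD x hev
  have h2 : curl u x = 0 := by rw [curl_eq_curlCLM, h1, map_zero]
  have hcurl : curl u =ᶠ[𝓝 x] fun _ => (0 : EuclideanSpace ℝ (Fin 3)) := by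
    filter_upwards [hev.eventually_nhds] with y hy
    rw [curl_eq_curlCLM, hD y hy, map_zero]
  refine ⟨h1, h2, ?_⟩
  rw [hcurl.fderiv_eq, fderiv_const_apply]

/-- A continuous real function vanishing off the support of a compactly supported field is integrable. [folklore] -/
theorem integrable_of_eq_zero_off_tsupport {u : EuclideanSpace ℝ (Fin 3) → EuclideanSpace ℝ (Fin 3)}
    (huc : HasCompactSupport u) {φ : EuclideanSpace ℝ (Fin 3) → ℝ} (hφ : Continuous φ)
    (h0 : ∀ x, x ∉ tsupport u → φ x = 0) : Integrable φ volume :=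
  hφ.integrable_of_hasCompactSupport (HasCompactSupport.intro huc fun x hx => h0 x hx)

/-- **`∫ f_R → ∫ f` from an `L² × L²` domination of the difference.**  If `f_R`, `f` are integrable (eventually),
`‖f_R(x) − f(x)‖ₑ ≤ C·g(x)·d_R(x)` with `C < ∞`, `∫ g² < ∞`, and `∫ d_R² → 0`, then `∫ f_R → ∫ f`. [folklore] -/
theorem tendsto_integral_of_sq_dominated {f : ℝ → EuclideanSpace ℝ (Fin 3) → ℝ} {f₀ : EuclideanSpace ℝ (Fin 3) → ℝ}
    {g : EuclideanSpace ℝ (Fin 3) → ℝ≥0∞} {d : ℝ → EuclideanSpace ℝ (Fin 3) → ℝ≥0∞} {C : ℝ≥0∞} (hC : C ≠ ⊤)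
    (hint : ∀ᶠ R in atTop, Integrable (f R) volume) (hint₀ : Integrable f₀ volume)
    (hg : Measurable g) (hQ : ∫⁻ x, g x ^ 2 < ⊤) (hd : ∀ R, Measurable (d R))
    (hle : ∀ᶠ R in atTop, ∀ x, ‖f R x - f₀ x‖ₑ ≤ C * g x * d R x)
    (he : Tendsto (fun R => ∫⁻ x, d R x ^ 2) atTop (𝓝 0)) :
    Tendsto (fun R => ∫ x, f R x) atTop (𝓝 (∫ x, f₀ x)) := by
  -- the extended-norm error tends to zero
  have hbound : ∀ᶠ R in atTop, ‖(∫ x, f R x) - ∫ x, f₀ x‖ₑ ≤ C * (∫⁻ x, g x ^ 2) ^ (1 / 2 : ℝ) * (∫⁻ x, d R x ^ 2) ^ (1 / 2 : ℝ) := by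
    filter_upwards [hint, hle] with R hR hR'
    rw [← integral_sub hR hint₀]
    refine (enorm_integral_le_lintegral_enorm _).trans ?_
    calc ∫⁻ x, ‖f R x - f₀ x‖ₑ ≤ ∫⁻ x, C * (g x * d R x) := lintegral_mono fun x => by rw [← mul_assoc]; exact hR' x
      _ = C * ∫⁻ x, g x * d R x := by rw [lintegral_const_mul' _ _ hC]
      _ ≤ C * ((∫⁻ x, g x ^ 2) ^ (1 / 2 : ℝ) * (∫⁻ x, d R x ^ 2) ^ (1 / 2 : ℝ)) := by
          gcongr; exact lintegral_mul_le_sqrt_mul_sqrt hg.aemeasurable (hd R).aemeasurable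
      _ = _ := by ring
  have hlim : Tendsto (fun R => C * (∫⁻ x, g x ^ 2) ^ (1 / 2 : ℝ) * (∫⁻ x, d R x ^ 2) ^ (1 / 2 : ℝ)) atTop (𝓝 0) := by
    have hsqrt : Tendsto (fun R => (∫⁻ x, d R x ^ 2) ^ (1 / 2 : ℝ)) atTop (𝓝 0) := by
      have hc := (ENNReal.continuous_rpow_const (y := (1 / 2 : ℝ))).tendsto (0 : ℝ≥0∞)
      rw [ENNReal.zero_rpow_of_pos (by norm_num : (0 : ℝ) < 1 / 2)] at hc
      exact hc.comp he
    have hK : C * (∫⁻ x, g x ^ 2) ^ (1 / 2 : ℝ) ≠ ⊤ :=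
      ENNReal.mul_ne_top hC (ENNReal.rpow_ne_top_of_nonneg (by norm_num) hQ.ne)
    simpa using ENNReal.Tendsto.const_mul hsqrt (Or.inr hK)
  have henorm : Tendsto (fun R => ‖(∫ x, f R x) - ∫ x, f₀ x‖ₑ) atTop (𝓝 0) :=
    tendsto_of_tendsto_of_tendsto_of_le_of_le' tendsto_const_nhds hlim (Eventually.of_forall fun _ => zero_le) hbound
  -- back to real numbers
  rw [tendsto_iff_norm_sub_tendsto_zero]
  have h := (ENNReal.tendsto_toReal ENNReal.zero_ne_top).comp henorm
  rw [ENNReal.toReal_zero] at h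
  refine h.congr fun R => ?_
  simp [toReal_enorm]

end ExtremiserLiouville

end Summit.NavierStokesRegularity.NavierStokesRegularity.Theorems

end
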